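import Mathlib
import HarnessLib
import Literature.MathematicalPhysics.QuantumLattice.AnisotropicSectors
import Summits.HubbardSuperconductivity.HubbardSuperconductivity.Theorems.KLProgrammeH10TwoPointLimitPerturbedFermiRadiusAccel
import Summits.HubbardSuperconductivity.HubbardSuperconductivity.Theorems.KLProgrammePerturbedFermiCurveHigherDerivs
import Summits.HubbardSuperconductivity.HubbardSuperconductivity.Theorems.KLProgrammeKLRegimeSplitFermiPointLevelC4

/-!
# Route `KLProgramme` — the perturbed Fermi curve `{ε₀ + δ = μ}` at THIRD and FOURTH order: `|u‴|`, `|u⁗|` for any root selection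
# under the lineage's hypotheses (`B : BandBounds a b`, `κ₀, …, κ₄`), i.e. BGM (2.40) `|∂ⁿ_θ u| ≤ Cₙ` for `n = 3, 4` with explicit `Cₙ`

Cell `gate-hubbard-kl`, seat hubbard-kl-k3c3-p3 (g2; row «implicit-function / monotonicity route»).  Instantiation of the abstract
modules `KLProgrammePerturbedFermiCurveLevelChain` / `…HigherDerivs` (p476128 / p476373) to the perturbed band `e = ε₀ + δ` of the
lineage (`…PerturbedFermiRadius/Smooth/Accel`, p4): the ENGINE child of crux K3 (stmt-HubbardSuperconductivity-19823) needs the angular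
derivatives of the frame's curve map up to order `4` QUANTITATIVELY for (E3g) `TwoLegAngularG` and (E3a-G); orders `1, 2` are the
lineage's `abs_deriv_le`, `abs_second_deriv_le`.  p1b g5's `…ImplicitRadiusDerivBounds` / `…SplitFermiPointC4Bounds` give orders `3, 4` by a
single-constant bootstrap, `|u^{(j)}| ≤ (31104·B⁴/d⁴)ʲ`, whose `4^{8jN}` growth does not fit the frozen (E3g) majorant `angBar` (p1b's
finding N-(E3g), STATUS 2026-08-26T22:58Z, «the alternative needs sharp hand-derived u‴, u⁗ formulas»).  THIS is that alternative: the
sharp, Faà-di-Bruno-structured bounds, AFFINE in the top-order sizes `κ₃, κ₄` (so `|u‴| = O(1 + κ₃)`, `|u⁗| = O(1 + κ₃ + κ₄)`, i.e.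
`O(4^N)`, `O(4^{2N})` for admissible frames — the graded growth `angBar`'s `4^{j(N+1)}` was typed for).

* (the free band's derivative norms `‖Dᵐ ε₀(k)‖ ≤ 4` are p1b's `norm_iteratedFDeriv_sqDispersion_le`, `…SplitFermiPointLevelC4`, imported;)
* §2 bookkeeping `‖fderiv ℝ (… (fderiv ℝ f))(p)‖ = ‖iteratedFDeriv ℝ m f p‖` for `m ≤ 4` (nested Fréchet derivatives, the currency of
  `abs_second_deriv_le` and of the hypotheses `‖D(Dδ)‖ ≤ κ₂`, versus Mathlib's `iteratedFDeriv`);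
* §3 the perturbed band at a root selection `u` of `{ε₀ + δ = μ}` (`IsBandFermiRadius (μ − δ(u θ·dir θ)) θ (u θ)` for all `θ`;
  `δ ∈ C⁴`, `|δ| ≤ κ₀`, `‖Dδ‖ ≤ κ₁ < Dt_min`, `‖D²δ‖ ≤ κ₂`, `‖D³δ‖ ≤ κ₃`, `‖D⁴δ‖ ≤ κ₄` on the closed square, `[μ − κ₀, μ + κ₀] ⊂ [a, b]`):
  the level identity, `C⁴`-regularity of `e` and `u`, the radial derivative `De(u·dir θ)[dir θ] = ∂_tF + Dδ[dir θ] ≥ Dt_min − κ₁`, the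
  sizes `‖Dᵐe‖ ≤ 4 + κ_m` at the curve point, `|u| ≤ π√2`, the uniform slope bound `|u′| ≤ (4 + κ₁)π√2/(Dt_min − κ₁)`, and the
  INCREMENTAL bounds (each order from the previous ones, so that consumers may insert the lineage's own `R₂`):
  `|u″ θ| ≤ ((4+κ₂)(R₁+π√2)² + (4+κ₁)(2R₁+π√2))/(Dt_min − κ₁)`,
  **`|u‴ θ| ≤ ((4+κ₃)K₁³ + 3(4+κ₂)K₁K₂ + (4+κ₁)(3R₂+3R₁+π√2))/(Dt_min − κ₁)`**,
  **`|u⁗ θ| ≤ ((4+κ₄)K₁⁴ + 6(4+κ₃)K₁²K₂ + 3(4+κ₂)K₂² + 4(4+κ₂)K₁K₃ + (4+κ₁)(4R₃+6R₂+4R₁+π√2))/(Dt_min − κ₁)`**,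
  `K₁ = R₁ + π√2`, `K₂ = R₂ + 2R₁ + π√2`, `K₃ = R₃ + 3R₂ + 3R₁ + π√2`, from `|u′ θ| ≤ R₁`, `|u″ θ| ≤ R₂`, `|u‴ θ| ≤ R₃` —
  affine in `κ₃`, `κ₄` (the orders that `FrameOK … N` lets grow like `4^N`, `4^{2N}`).

Everything is PROVED; no definitions, nothing about the Hubbard model.  References: BGM 2006 §2.4 Lemma 2.1 (2.40)
[cite: BenfattoGiulianiMastropietro2006]; HOME/prover-p4/INVERSION-NOTE.md Lemma I (ii)–(iii).
-/

noncomputable section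

namespace Summit.HubbardSuperconductivity.HubbardSuperconductivity.Theorems.PerturbedFermiCurve

set_option linter.dupNamespace false -- summit = problem name (single-conjunct summit), D-0017
set_option maxSynthPendingDepth 3 -- nested operator-norm instances (third/fourth Fréchet derivatives)

open Real Set
open Literature.MathematicalPhysics.QuantumLattice Literature.MathematicalPhysics.QuantumLattice.BandSectorCounting

/-! ## §2 Nested Fréchet derivatives versus `iteratedFDeriv`: the norms agree -/

section NestedNorms

variable {V F : Type*} [NormedAddCommGroup V] [NormedSpace ℝ V] [NormedAddCommGroup F] [NormedSpace ℝ F]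

/-- `‖Df(p)‖ = ‖iteratedFDeriv 1 f p‖`. [folklore] -/
theorem norm_fderiv_eq_norm_iteratedFDeriv_one (f : V → F) (p : V) : ‖fderiv ℝ f p‖ = ‖iteratedFDeriv ℝ 1 f p‖ := by
  have h := norm_iteratedFDeriv_fderiv (𝕜 := ℝ) (f := f) (x := p) (n := 0)
  rw [norm_iteratedFDeriv_zero] at h
  exact h

/-- `‖D(Df)(p)‖ = ‖iteratedFDeriv 2 f p‖`. [folklore] -/
theorem norm_fderiv_two_eq_norm_iteratedFDeriv (f : V → F) (p : V) :
    ‖fderiv ℝ (fderiv ℝ f) p‖ = ‖iteratedFDeriv ℝ 2 f p‖ := by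
  rw [norm_fderiv_eq_norm_iteratedFDeriv_one (fderiv ℝ f) p]
  exact norm_iteratedFDeriv_fderiv (𝕜 := ℝ) (f := f) (x := p) (n := 1)

/-- `‖D(D(Df))(p)‖ = ‖iteratedFDeriv 3 f p‖`. [folklore] -/
theorem norm_fderiv_three_eq_norm_iteratedFDeriv (f : V → F) (p : V) :
    ‖fderiv ℝ (fderiv ℝ (fderiv ℝ f)) p‖ = ‖iteratedFDeriv ℝ 3 f p‖ := by
  rw [norm_fderiv_two_eq_norm_iteratedFDeriv (fderiv ℝ f) p]
  exact norm_iteratedFDeriv_fderiv (𝕜 := ℝ) (f := f) (x := p) (n := 2)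

/-- `‖D⁴f(p)‖ (nested) = ‖iteratedFDeriv 4 f p‖`. [folklore] -/
theorem norm_fderiv_four_eq_norm_iteratedFDeriv (f : V → F) (p : V) :
    ‖fderiv ℝ (fderiv ℝ (fderiv ℝ (fderiv ℝ f))) p‖ = ‖iteratedFDeriv ℝ 4 f p‖ := by
  rw [norm_fderiv_three_eq_norm_iteratedFDeriv (fderiv ℝ f) p]
  exact norm_iteratedFDeriv_fderiv (𝕜 := ℝ) (f := f) (x := p) (n := 3)

end NestedNorms

/-! ## §3 The perturbed band `e = ε₀ + δ` at a root selection: orders three and four -/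

section Band

variable {a b : ℝ} (B : BandBounds a b) {δ : (Fin 2 → ℝ) → ℝ} (hδs : ContDiff ℝ 4 δ)
  {κ₀ κ₁ μ : ℝ} (hδ : ∀ k : Fin 2 → ℝ, (∀ i, |k i| ≤ π) → |δ k| ≤ κ₀) (hlo : a ≤ μ - κ₀) (hhi : μ + κ₀ ≤ b)
  (hκ : ∀ k : Fin 2 → ℝ, (∀ i, |k i| ≤ π) → ‖fderiv ℝ δ k‖ ≤ κ₁) (hκ₁ : κ₁ < B.Dtmin)
  {u : ℝ → ℝ} (hu : ∀ θ, IsBandFermiRadius (μ - δ (u θ • dir θ)) θ (u θ))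
include B hδs hδ hlo hhi hκ hκ₁ hu

omit B hδs hδ hlo hhi hκ hκ₁ in
/-- The level identity of the perturbed band along the root curve: `(ε₀ + δ)(u θ · dir θ) = μ`. [folklore] -/
theorem pertBand_level (ϑ : ℝ) : (fun k : Fin 2 → ℝ => sqDispersion k + δ k) (u ϑ • dir ϑ) = μ :=
  ((isBandFermiRadius_shifted_iff δ μ ϑ (u ϑ)).1 (hu ϑ)).2

omit B hδ hlo hhi hκ hκ₁ hu in
/-- The perturbed band is `C⁴`. [folklore] -/
theorem contDiff_pertBand : ContDiff ℝ 4 (fun k : Fin 2 → ℝ => sqDispersion k + δ k) :=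
  contDiff_sqDispersion.add hδs

/-- Any root selection is `C⁴` (the lineage's implicit-function theorem at `n = 4`). [folklore] -/
theorem contDiff_four_of_isRoot : ContDiff ℝ 4 u := contDiff_of_isRoot B hδs (by norm_num) hδ hlo hhi hκ hκ₁ hu

omit B hδ hlo hhi hκ hκ₁ hu in
/-- **The radial derivative of the perturbed band along a ray**: `D(ε₀ + δ)(t·dir θ)[dir θ] = ∂_tF(θ, t) + Dδ(t·dir θ)[dir θ]`. [folklore] -/
theorem fderiv_pertBand_apply_dir (θ t : ℝ) :
    fderiv ℝ (fun k : Fin 2 → ℝ => sqDispersion k + δ k) (t • dir θ) (dir θ) =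
      rayDispersionDt θ t + fderiv ℝ δ (t • dir θ) (dir θ) := by
  have hd : DifferentiableAt ℝ δ (t • dir θ) := (hδs.differentiable (by norm_num)) _
  have he : DifferentiableAt ℝ (fun k : Fin 2 → ℝ => sqDispersion k + δ k) (t • dir θ) :=
    ((contDiff_pertBand hδs).differentiable (by norm_num)) _
  have h1 := he.hasFDerivAt.comp_hasDerivAt t (hasDerivAt_smul_dir θ t)
  have h1' : HasDerivAt (fun s : ℝ => sqDispersion (s • dir θ) + δ (s • dir θ))
      (fderiv ℝ (fun k : Fin 2 → ℝ => sqDispersion k + δ k) (t • dir θ) (dir θ)) t := h1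
  have h2 : HasDerivAt (fun s : ℝ => sqDispersion (s • dir θ) + δ (s • dir θ))
      (rayDispersionDt θ t + fderiv ℝ δ (t • dir θ) (dir θ)) t := hasDerivAt_pertLevel_radius hd
  exact h1'.unique h2

omit hδs hκ₁ in
/-- **Radial transversality of the perturbed band at the curve**: `D(ε₀ + δ)(u θ·dir θ)[dir θ] ≥ Dt_min − κ₁`.
[cite: BenfattoGiulianiMastropietro2006, §2.4 Lemma 2.1] -/
theorem Dtmin_sub_le_fderiv_pertBand_dir (hδs : ContDiff ℝ 4 δ) (θ : ℝ) :
    B.Dtmin - κ₁ ≤ fderiv ℝ (fun k : Fin 2 → ℝ => sqDispersion k + δ k) (u θ • dir θ) (dir θ) := by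
  rw [fderiv_pertBand_apply_dir hδs θ (u θ)]
  exact Dtmin_sub_le_pertDt B hδ hlo hhi hκ hu θ

omit hδs hκ hκ₁ in
/-- `|u θ| ≤ π√2` (the root lies in the closed square). [folklore] -/
theorem abs_root_le_pi_mul_sqrt_two (θ : ℝ) : |u θ| ≤ π * Real.sqrt 2 := by
  rw [abs_of_pos (mem_Ioo_of_shifted B hδ hlo hhi (hu θ)).1]
  exact root_le_pi_mul_sqrt_two B hδ hlo hhi hu θ

/-- **Uniform slope bound**: `|u′ θ| ≤ (4 + κ₁)·π√2/(Dt_min − κ₁)`. [folklore] -/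
theorem abs_deriv_le_uniform (θ : ℝ) : |deriv u θ| ≤ (4 + κ₁) * (π * Real.sqrt 2) / (B.Dtmin - κ₁) := by
  have hsq := abs_apply_le_pi_of_isBandFermiRadius (hu θ)
  have hκ₁0 : 0 ≤ κ₁ := le_trans (norm_nonneg _) (hκ _ hsq)
  have hden : 0 < B.Dtmin - κ₁ := sub_pos.2 hκ₁
  refine (abs_deriv_le B hδs (by norm_num) hδ hlo hhi hκ hκ₁ hu θ).trans ?_
  exact div_le_div_of_nonneg_right (mul_le_mul_of_nonneg_left (root_le_pi_mul_sqrt_two B hδ hlo hhi hu θ) (by linarith))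
    hden.le

omit B hδ hlo hhi hκ₁ in
/-- `‖D(ε₀ + δ)(u θ·dir θ)‖ ≤ 4 + κ₁`. [folklore] -/
theorem norm_fderiv_pertBand_le (θ : ℝ) :
    ‖fderiv ℝ (fun k : Fin 2 → ℝ => sqDispersion k + δ k) (u θ • dir θ)‖ ≤ 4 + κ₁ := by
  have hsq := abs_apply_le_pi_of_isBandFermiRadius (hu θ)
  rw [norm_fderiv_eq_norm_iteratedFDeriv_one, show (fun k : Fin 2 → ℝ => sqDispersion k + δ k) = sqDispersion + δ from rfl,
    iteratedFDeriv_add_apply contDiff_sqDispersion.contDiffAt (hδs.of_le (by norm_num)).contDiffAt]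
  refine (norm_add_le _ _).trans (add_le_add (norm_iteratedFDeriv_sqDispersion_le 1 _) ?_)
  rw [← norm_fderiv_eq_norm_iteratedFDeriv_one]
  exact hκ _ hsq

omit B hδ hlo hhi hκ hκ₁ in
/-- `‖D²(ε₀ + δ)(u θ·dir θ)‖ ≤ 4 + κ₂` from `‖D(Dδ)‖ ≤ κ₂` on the closed square. [folklore] -/
theorem norm_fderiv_two_pertBand_le {κ₂ : ℝ} (hκ₂ : ∀ k : Fin 2 → ℝ, (∀ i, |k i| ≤ π) → ‖fderiv ℝ (fderiv ℝ δ) k‖ ≤ κ₂)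
    (θ : ℝ) : ‖fderiv ℝ (fderiv ℝ (fun k : Fin 2 → ℝ => sqDispersion k + δ k)) (u θ • dir θ)‖ ≤ 4 + κ₂ := by
  have hsq := abs_apply_le_pi_of_isBandFermiRadius (hu θ)
  rw [norm_fderiv_two_eq_norm_iteratedFDeriv, show (fun k : Fin 2 → ℝ => sqDispersion k + δ k) = sqDispersion + δ from rfl,
    iteratedFDeriv_add_apply contDiff_sqDispersion.contDiffAt (hδs.of_le (by norm_num)).contDiffAt]
  refine (norm_add_le _ _).trans (add_le_add (norm_iteratedFDeriv_sqDispersion_le 2 _) ?_)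
  rw [← norm_fderiv_two_eq_norm_iteratedFDeriv]
  exact hκ₂ _ hsq

omit B hδ hlo hhi hκ hκ₁ in
/-- `‖D³(ε₀ + δ)(u θ·dir θ)‖ ≤ 4 + κ₃` from `‖D³δ‖ ≤ κ₃` on the closed square. [folklore] -/
theorem norm_fderiv_three_pertBand_le {κ₃ : ℝ}
    (hκ₃ : ∀ k : Fin 2 → ℝ, (∀ i, |k i| ≤ π) → ‖fderiv ℝ (fderiv ℝ (fderiv ℝ δ)) k‖ ≤ κ₃) (θ : ℝ) :
    ‖fderiv ℝ (fderiv ℝ (fderiv ℝ (fun k : Fin 2 → ℝ => sqDispersion k + δ k))) (u θ • dir θ)‖ ≤ 4 + κ₃ := by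
  have hsq := abs_apply_le_pi_of_isBandFermiRadius (hu θ)
  rw [norm_fderiv_three_eq_norm_iteratedFDeriv, show (fun k : Fin 2 → ℝ => sqDispersion k + δ k) = sqDispersion + δ from rfl,
    iteratedFDeriv_add_apply contDiff_sqDispersion.contDiffAt (hδs.of_le (by norm_num)).contDiffAt]
  refine (norm_add_le _ _).trans (add_le_add (norm_iteratedFDeriv_sqDispersion_le 3 _) ?_)
  rw [← norm_fderiv_three_eq_norm_iteratedFDeriv]
  exact hκ₃ _ hsq

omit B hδ hlo hhi hκ hκ₁ in
/-- `‖D⁴(ε₀ + δ)(u θ·dir θ)‖ ≤ 4 + κ₄` from `‖D⁴δ‖ ≤ κ₄` on the closed square. [folklore] -/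
theorem norm_fderiv_four_pertBand_le {κ₄ : ℝ}
    (hκ₄ : ∀ k : Fin 2 → ℝ, (∀ i, |k i| ≤ π) → ‖fderiv ℝ (fderiv ℝ (fderiv ℝ (fderiv ℝ δ))) k‖ ≤ κ₄) (θ : ℝ) :
    ‖fderiv ℝ (fderiv ℝ (fderiv ℝ (fderiv ℝ (fun k : Fin 2 → ℝ => sqDispersion k + δ k)))) (u θ • dir θ)‖ ≤ 4 + κ₄ := by
  have hsq := abs_apply_le_pi_of_isBandFermiRadius (hu θ)
  rw [norm_fderiv_four_eq_norm_iteratedFDeriv, show (fun k : Fin 2 → ℝ => sqDispersion k + δ k) = sqDispersion + δ from rfl,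
    iteratedFDeriv_add_apply contDiff_sqDispersion.contDiffAt hδs.contDiffAt]
  refine (norm_add_le _ _).trans (add_le_add (norm_iteratedFDeriv_sqDispersion_le 4 _) ?_)
  rw [← norm_fderiv_four_eq_norm_iteratedFDeriv]
  exact hκ₄ _ hsq

/-- **Order 2 (incremental form)**: from `|u′ θ| ≤ R₁` and `‖D(Dδ)‖ ≤ κ₂`,
`|u″ θ| ≤ ((4+κ₂)(R₁+π√2)² + (4+κ₁)(2R₁+π√2))/(Dt_min − κ₁)` (cf. the lineage's `abs_second_deriv_le`).
[cite: BenfattoGiulianiMastropietro2006, §2.4 Lemma 2.1 (2.41)] -/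
theorem abs_deriv_two_le_of_isRoot {κ₂ : ℝ} (hκ₂ : ∀ k : Fin 2 → ℝ, (∀ i, |k i| ≤ π) → ‖fderiv ℝ (fderiv ℝ δ) k‖ ≤ κ₂)
    {θ R₁ : ℝ} (hR₁ : |deriv u θ| ≤ R₁) :
    |deriv (deriv u) θ| ≤
      ((4 + κ₂) * (R₁ + π * Real.sqrt 2) ^ 2 + (4 + κ₁) * (2 * R₁ + π * Real.sqrt 2)) / (B.Dtmin - κ₁) :=
  abs_deriv_two_le_of_polar_level (contDiff_pertBand hδs) (contDiff_four_of_isRoot B hδs hδ hlo hhi hκ hκ₁ hu)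
    (pertBand_level hu) (sub_pos.2 hκ₁) (Dtmin_sub_le_fderiv_pertBand_dir B hδ hlo hhi hκ hu hδs θ)
    (norm_fderiv_pertBand_le hδs hκ hu θ) (norm_fderiv_two_pertBand_le hδs hu hκ₂ θ)
    (abs_root_le_pi_mul_sqrt_two B hδ hlo hhi hu θ) hR₁

/-- **Order 3 — BGM (2.40) for `n = 3` with an explicit constant (incremental form)**: from `|u′ θ| ≤ R₁`, `|u″ θ| ≤ R₂`,
`‖D²δ‖ ≤ κ₂`, `‖D³δ‖ ≤ κ₃`:
`|u‴ θ| ≤ ((4+κ₃)(R₁+π√2)³ + 3(4+κ₂)(R₁+π√2)(R₂+2R₁+π√2) + (4+κ₁)(3R₂+3R₁+π√2))/(Dt_min − κ₁)` — affine in `κ₃`.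
[cite: BenfattoGiulianiMastropietro2006, §2.4 Lemma 2.1 (2.40)] -/
theorem abs_deriv_three_le_of_isRoot {κ₂ κ₃ : ℝ}
    (hκ₂ : ∀ k : Fin 2 → ℝ, (∀ i, |k i| ≤ π) → ‖fderiv ℝ (fderiv ℝ δ) k‖ ≤ κ₂)
    (hκ₃ : ∀ k : Fin 2 → ℝ, (∀ i, |k i| ≤ π) → ‖fderiv ℝ (fderiv ℝ (fderiv ℝ δ)) k‖ ≤ κ₃)
    {θ R₁ R₂ : ℝ} (hR₁ : |deriv u θ| ≤ R₁) (hR₂ : |deriv (deriv u) θ| ≤ R₂) :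
    |deriv (deriv (deriv u)) θ| ≤
      ((4 + κ₃) * (R₁ + π * Real.sqrt 2) ^ 3 + 3 * (4 + κ₂) * (R₁ + π * Real.sqrt 2) * (R₂ + 2 * R₁ + π * Real.sqrt 2) +
          (4 + κ₁) * (3 * R₂ + 3 * R₁ + π * Real.sqrt 2)) / (B.Dtmin - κ₁) :=
  abs_deriv_three_le_of_polar_level (contDiff_pertBand hδs) (contDiff_four_of_isRoot B hδs hδ hlo hhi hκ hκ₁ hu)
    (pertBand_level hu) (sub_pos.2 hκ₁) (Dtmin_sub_le_fderiv_pertBand_dir B hδ hlo hhi hκ hu hδs θ)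
    (norm_fderiv_pertBand_le hδs hκ hu θ) (norm_fderiv_two_pertBand_le hδs hu hκ₂ θ)
    (norm_fderiv_three_pertBand_le hδs hu hκ₃ θ) (abs_root_le_pi_mul_sqrt_two B hδ hlo hhi hu θ) hR₁ hR₂

/-- **Order 4 — BGM (2.40) for `n = 4` with an explicit constant (incremental form)**: from `|u′ θ| ≤ R₁`, `|u″ θ| ≤ R₂`,
`|u‴ θ| ≤ R₃`, `‖D²δ‖ ≤ κ₂`, `‖D³δ‖ ≤ κ₃`, `‖D⁴δ‖ ≤ κ₄`, with `K₁ = R₁+π√2`, `K₂ = R₂+2R₁+π√2`, `K₃ = R₃+3R₂+3R₁+π√2`: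
`|u⁗ θ| ≤ ((4+κ₄)K₁⁴ + 6(4+κ₃)K₁²K₂ + 3(4+κ₂)K₂² + 4(4+κ₂)K₁K₃ + (4+κ₁)(4R₃+6R₂+4R₁+π√2))/(Dt_min − κ₁)` — affine in `κ₃` and
in `κ₄`. [cite: BenfattoGiulianiMastropietro2006, §2.4 Lemma 2.1 (2.40)] -/
theorem abs_deriv_four_le_of_isRoot {κ₂ κ₃ κ₄ : ℝ}
    (hκ₂ : ∀ k : Fin 2 → ℝ, (∀ i, |k i| ≤ π) → ‖fderiv ℝ (fderiv ℝ δ) k‖ ≤ κ₂)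
    (hκ₃ : ∀ k : Fin 2 → ℝ, (∀ i, |k i| ≤ π) → ‖fderiv ℝ (fderiv ℝ (fderiv ℝ δ)) k‖ ≤ κ₃)
    (hκ₄ : ∀ k : Fin 2 → ℝ, (∀ i, |k i| ≤ π) → ‖fderiv ℝ (fderiv ℝ (fderiv ℝ (fderiv ℝ δ))) k‖ ≤ κ₄)
    {θ R₁ R₂ R₃ : ℝ} (hR₁ : |deriv u θ| ≤ R₁) (hR₂ : |deriv (deriv u) θ| ≤ R₂) (hR₃ : |deriv (deriv (deriv u)) θ| ≤ R₃) :
    |deriv (deriv (deriv (deriv u))) θ| ≤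
      ((4 + κ₄) * (R₁ + π * Real.sqrt 2) ^ 4 +
            6 * (4 + κ₃) * (R₁ + π * Real.sqrt 2) ^ 2 * (R₂ + 2 * R₁ + π * Real.sqrt 2) +
            3 * (4 + κ₂) * (R₂ + 2 * R₁ + π * Real.sqrt 2) ^ 2 +
            4 * (4 + κ₂) * (R₁ + π * Real.sqrt 2) * (R₃ + 3 * R₂ + 3 * R₁ + π * Real.sqrt 2) +
          (4 + κ₁) * (4 * R₃ + 6 * R₂ + 4 * R₁ + π * Real.sqrt 2)) / (B.Dtmin - κ₁) :=
  abs_deriv_four_le_of_polar_level (contDiff_pertBand hδs) (contDiff_four_of_isRoot B hδs hδ hlo hhi hκ hκ₁ hu)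
    (pertBand_level hu) (sub_pos.2 hκ₁) (Dtmin_sub_le_fderiv_pertBand_dir B hδ hlo hhi hκ hu hδs θ)
    (norm_fderiv_pertBand_le hδs hκ hu θ) (norm_fderiv_two_pertBand_le hδs hu hκ₂ θ)
    (norm_fderiv_three_pertBand_le hδs hu hκ₃ θ) (norm_fderiv_four_pertBand_le hδs hu hκ₄ θ)
    (abs_root_le_pi_mul_sqrt_two B hδ hlo hhi hu θ) hR₁ hR₂ hR₃

end Band

end Summit.HubbardSuperconductivity.HubbardSuperconductivity.Theorems.PerturbedFermiCurve

end
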